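import Summits.QuantumFields.YangMills.Theses.PencilRigidity

/-!
# `CurvatureKernelBound` — negative lemmas I: handles and the degenerate inhabitants

Supports crux item `stmt-QuantumFields-11687` (`PencilRigidity.CurvatureKernelBound`: for every compact simple
`G`, `r`, `sch` and one-species `S₁` carrying the curvature package `W₁`, the two-point function of `S₁` on `⁰𝒮`
is integration against a REAL kernel `K(x₀ − x₁)`, continuous off `0`, with `|K x| ≤ C (1 + ‖x‖^(η−10))`,
`η > 0`). Standing disprover's negative lemmas (refuter, cdisprove); no conclusion below asserts a Theses
statement positively.

* §A handles: `KernelData K C η` (the three kernel clauses of the conclusion), `RepresentsCLM T K` (the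
  representation clause, for any two-point functional `T`), `KernelConclusion S₁` (the conclusion verbatim),
  `W1 G r sch S₁` (the curvature package, verbatim `let W₁ := …` body) and
  `curvatureKernelBound_iff : CurvatureKernelBound ↔ ∀ G …, W1 G r sch S₁ → KernelConclusion S₁` (`Iff.rfl`).
* §A' `kernelConclusion_of_const`: every inhabitant whose two-point function on `⁰𝒮` is `κ ∫ F` (zero scheme
  `κ = 0`; `β ≡ 0` and strong-coupling ultralocal limits `κ = (one-point constant)²`) satisfies the conclusion
  with `K ≡ κ`, `η = 10` — the cheap regimes carry NO counterexample. [folklore]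
-/

open scoped BigOperators Topology SchwartzMap
open MeasureTheory Filter Set
open Literature.MathematicalPhysics.QuantumLattice Literature.MathematicalPhysics.AQFT
  Literature.MathematicalPhysics.QuantumFieldTheory

noncomputable section

namespace Summit.QuantumFields.YangMills.Theorems.CurvatureKernelBound.Negative

/-- Euclidean `ℝ⁴`, time = coordinate `0` (as in the route file). [folklore] -/
abbrev E4 : Type := EuclideanSpace ℝ (Fin 4)

/-- `dim (ℝ⁴)² = 8`. -/
theorem finrank_config : Module.finrank ℝ (Fin 2 → E4) = 8 := by
  simp [Module.finrank_pi_fintype]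

/-- Lebesgue measure on `(ℝ⁴)²` has temperate growth (instance supplied by name; inference from
`IsAddHaarMeasure` does not fire on the `Pi` measure space). -/
instance hasTemperateGrowth_config : (volume : Measure (Fin 2 → E4)).HasTemperateGrowth :=
  Measure.IsAddHaarMeasure.instHasTemperateGrowth

/-! ## §A Handles -/

/-- The kernel data `(K, C, η)` asked for by the conclusion of the crux (verbatim clauses). -/
def KernelData (K : E4 → ℝ) (C η : ℝ) : Prop :=
  0 < η ∧ ContinuousOn K {x : E4 | x ≠ 0} ∧ ∀ x : E4, x ≠ 0 → |K x| ≤ C * (1 + ‖x‖ ^ (η - 10))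

/-- Two-point functionals (the level at which everything below is stated). -/
abbrev TwoPointCLM : Type := 𝓢((Fin 2 → E4), ℂ) →L[ℂ] ℂ

/-- `K` represents the two-point functional `T` on `⁰𝒮` (verbatim last clause of the crux). -/
def RepresentsCLM (T : TwoPointCLM) (K : E4 → ℝ) : Prop :=
  ∀ F : 𝓢((Fin 2 → E4), ℂ), IsOffDiagonal F →
    Integrable (fun x : Fin 2 → E4 => (K (x 0 - x 1) : ℂ) * F x) ∧
      T F = ∫ x : Fin 2 → E4, (K (x 0 - x 1) : ℂ) * F x

/-- `K` represents the two-point function of the family `S₁` on `⁰𝒮`. -/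
abbrev Represents (S₁ : SchwingerFamily E4) (K : E4 → ℝ) : Prop := RepresentsCLM (S₁ 2) K

/-- The conclusion of the crux for a one-species family `S₁` (verbatim). -/
def KernelConclusion (S₁ : SchwingerFamily E4) : Prop :=
  ∃ (K : E4 → ℝ) (C η : ℝ), 0 < η ∧ ContinuousOn K {x : E4 | x ≠ 0} ∧
    (∀ x : E4, x ≠ 0 → |K x| ≤ C * (1 + ‖x‖ ^ (η - 10))) ∧
    ∀ F : SchwartzMap (Fin 2 → E4) ℂ, IsOffDiagonal F →
      MeasureTheory.Integrable (fun x : Fin 2 → E4 => (K (x 0 - x 1) : ℂ) * F x) ∧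
        S₁ 2 F = ∫ x : Fin 2 → E4, (K (x 0 - x 1) : ℂ) * F x

/-- `KernelConclusion` unbundled as kernel data + representation. [folklore] -/
theorem kernelConclusion_iff (S₁ : SchwingerFamily E4) :
    KernelConclusion S₁ ↔ ∃ (K : E4 → ℝ) (C η : ℝ), KernelData K C η ∧ Represents S₁ K := by
  constructor
  · rintro ⟨K, C, η, hη, hc, hb, hr⟩; exact ⟨K, C, η, ⟨hη, hc, hb⟩, hr⟩
  · rintro ⟨K, C, η, ⟨hη, hc, hb⟩, hr⟩; exact ⟨K, C, η, hη, hc, hb, hr⟩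

/-- The curvature package `W₁ r sch S₁` of the crux (verbatim `let W₁ := …` body). -/
def W1 (G : Type) [Group G] [TopologicalSpace G] [IsTopologicalGroup G] [CompactSpace G]
    [MeasurableSpace G] [BorelSpace G]
    (r : LatticeRep G) (sch : SpeciesScheme (YMSpecies G)) (S₁ : SchwingerFamily E4) : Prop :=
  (∀ (n : ℕ), n ≠ 0 → ∀ (f : Fin n → SchwartzMap E4 ℝ) (F : SchwartzMap (Fin n → E4) ℂ),
      IsTensorOf F (fun i => ofRealTest (f i)) → IsOffDiagonal F →
        Filter.Tendsto (fun k : ℕ => ((latticeSchwinger r.ρ sch (fun s => s.F) k n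
          (fun _ => r.curvature) f : ℝ) : ℂ)) Filter.atTop (nhds (S₁ n F))) ∧
    (S₁.toLabelled.IsNormalized ∧ S₁.toLabelled.IsHermitian ∧ S₁.toLabelled.HasLinearGrowth ∧
      S₁.toLabelled.IsReflectionPositive ∧ S₁.toLabelled.IsSymmetric ∧
        S₁.toLabelled.HasClusterProperty) ∧
    (∀ (n : ℕ) (a : E4) (F : SchwartzMap (Fin n → E4) ℂ), IsOffDiagonal F →
      S₁ n (translateMulti a F) = S₁ n F) ∧
    (∀ (R : E4 ≃ₗᵢ[ℝ] E4), LinearMap.det (R.toLinearEquiv : E4 →ₗ[ℝ] E4) = 1 →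
      (∀ i : Fin 4, ∃ j : Fin 4, R (EuclideanSpace.single i 1) = EuclideanSpace.single j 1 ∨
        R (EuclideanSpace.single i 1) = -EuclideanSpace.single j 1) →
      ∀ (n : ℕ) (F : SchwartzMap (Fin n → E4) ℂ), IsOffDiagonal F →
        S₁ n (linActMulti R F) = S₁ n F) ∧
    (∃ Δ : ℝ, 0 < Δ ∧ S₁.toLabelled.HasMassGap Δ ∧ HasLatticeMassGap r sch Δ)

/-- The crux, unfolded: `W₁ ⇒ KernelConclusion` for every compact simple `G`, `r`, `sch`, `S₁`. -/
theorem curvatureKernelBound_iff :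
    Summit.QuantumFields.YangMills.Theses.PencilRigidity.CurvatureKernelBound ↔
      ∀ (G : Type) [Group G] [TopologicalSpace G] [IsTopologicalGroup G] [CompactSpace G],
        IsCompactSimpleLieGroup G →
          letI : MeasurableSpace G := borel G
          haveI : BorelSpace G := ⟨rfl⟩
          ∀ (r : LatticeRep G) (sch : SpeciesScheme (YMSpecies G)) (S₁ : SchwingerFamily E4),
            W1 G r sch S₁ → KernelConclusion S₁ :=
  Iff.rfl

/-! ## §A' Degenerate inhabitants satisfy the conclusion -/

/-- A family whose two-point function on `⁰𝒮` is `κ ∫ F` (zero scheme: `κ = 0`; ultralocal /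
constant-field limits: `κ = (one-point constant)²`) satisfies the conclusion with `K ≡ κ`,
`C = |κ|`, `η = 10`. -/
theorem kernelConclusion_of_const (S₁ : SchwingerFamily E4) (κ : ℝ)
    (h : ∀ F : 𝓢((Fin 2 → E4), ℂ), IsOffDiagonal F → S₁ 2 F = (κ : ℂ) * ∫ x : Fin 2 → E4, F x) :
    KernelConclusion S₁ := by
  refine ⟨fun _ => κ, |κ|, 10, by norm_num, continuousOn_const, fun x _ => ?_, fun F hF => ⟨?_, ?_⟩⟩
  · norm_num
    linarith [abs_nonneg κ]
  · exact (F.integrable.const_mul (κ : ℂ))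
  · rw [h F hF, ← integral_const_mul]

end Summit.QuantumFields.YangMills.Theorems.CurvatureKernelBound.Negative
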